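import Mathlib.Data.Finset.Card
import Mathlib.Data.Finset.Basic
import Mathlib.Order.Basic
import HarnessLib

/-!
# Route `GenusKolyvaginAtTwo`, crux L_T `PowDvdShaCardAtTwoRT` (stmt-BirchSwinnertonDyer-23242), LINE 18 stub L, bottom rung:
# THE k-MINIMAL WITNESS LOOP — «induction on k» of the S-bot engine in its ∃-form

Width seat `bsd-line-gk2-p4` g18 (cell `bsd-f1-sign2`), `--supports 23242 --as helper`.  THEOREMS ONLY (finite sets; no definition,
no `sorry`; standard axioms).  BSD is NOT proved by any of this; neither is the crux nor stub L.

WHY (LEAD memo `Cruxes/PowDvdShaCardAtTwoRT/Lines/plus-descent-lead-g16.md` §1–§2, §7 (iii)).  The bottom-rung ENGINE is a contradiction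
at a `k`-MINIMAL primitive product `n` (`k = #` non-deep primes of `n`, `k ≥ 1`): assuming that EVERY swap `(n ∖ ℓ) ∪ {ℓ′}` of a
non-deep `ℓ ∈ n` for a deep `ℓ′ ∉ n` is imprimitive (which is what minimality of `k` gives), reciprocity is violated.  Its
contrapositive supplies SOME non-deep `ℓ ∈ n` and SOME deep `ℓ′ ∉ n` with the swap primitive — not a swap at a PRESCRIBED `ℓ₀` as the
tree's `…RTBottomRungRat.exists_deep_of_swap` wants (`hstep : ∀ ℓ₀ ∈ S, ¬ Deep ℓ₀ → ∃ ℓ, …`).  This file is the loop for the weaker,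
engine-shaped step: from any admissible start, an admissible set of the same size ALL of whose elements are deep.
* `exists_all_deep_of_exists_swap` — step `∀ S, Adm S → (∃ ℓ₀ ∈ S, ¬Deep ℓ₀) → ∃ ℓ₀ ∈ S, ¬Deep ℓ₀ ∧ ∃ ℓ, Deep ℓ ∧ ℓ ∉ S ∧
  Adm (insert ℓ (S.erase ℓ₀))` ⟹ `∃ S, Adm S ∧ #S = #S₀ ∧ ∀ l ∈ S, Deep l` (induction on the number of non-deep elements).
* `exists_all_deep_of_engine` — the same with the step in the engine's contradiction form
  `Adm S → ℓ₀ ∈ S → ¬Deep ℓ₀ → (∀ ℓ₁ ∈ S, ¬Deep ℓ₁ → ∀ ℓ, Deep ℓ → ℓ ∉ S → ¬Adm (insert ℓ (S.erase ℓ₁))) → False`.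
HONEST FRAMING: folklore bookkeeping; the arithmetic is the engine (LEAD).  Closes nothing.  BSD is NOT proved by any of this.

References: [McCallumLMS1991] §5 proof of Prop. 5.2; [Kolyvagin1991MathAnn] Thm. 2.2 (proof).
-/

set_option autoImplicit false
-- `Summit.<P>.<Sub>` repeats `BirchSwinnertonDyer` by the tree's layout convention (D-0017)
set_option linter.dupNamespace false

namespace Summit.BirchSwinnertonDyer.BirchSwinnertonDyer.Theorems.GenusExact.PlusDescent

/-- **The k-minimal witness loop (∃-form of the swap).**  If from every admissible `S` containing a non-deep element one can swap
SOME non-deep `ℓ₀ ∈ S` for SOME deep `ℓ ∉ S` keeping admissibility, then every admissible `S₀` leads to an admissible set of the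
same size consisting of deep elements only (induction on the number of non-deep elements). [cite: McCallumLMS1991, §5 proof of Prop. 5.2] -/
theorem exists_all_deep_of_exists_swap (Deep : ℕ → Prop) (Adm : Finset ℕ → Prop)
    (hstep : ∀ S, Adm S → (∃ ℓ₀ ∈ S, ¬ Deep ℓ₀) →
      ∃ ℓ₀ ∈ S, ¬ Deep ℓ₀ ∧ ∃ ℓ, Deep ℓ ∧ ℓ ∉ S ∧ Adm (insert ℓ (S.erase ℓ₀)))
    (S₀ : Finset ℕ) (hS₀ : Adm S₀) :
    ∃ S, Adm S ∧ S.card = S₀.card ∧ ∀ l ∈ S, Deep l := by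
  classical
  -- induction on the number of non-deep elements
  suffices key : ∀ (k : ℕ) (S : Finset ℕ), Adm S → (S.filter fun l ↦ ¬ Deep l).card ≤ k →
      ∃ S', Adm S' ∧ S'.card = S.card ∧ ∀ l ∈ S', Deep l from
    key _ S₀ hS₀ le_rfl
  intro k
  induction k with
  | zero =>
    intro S hS hk
    refine ⟨S, hS, rfl, fun l hl ↦ ?_⟩
    by_contra hnd
    have hmem : l ∈ S.filter fun l ↦ ¬ Deep l := Finset.mem_filter.mpr ⟨hl, hnd⟩
    rw [Nat.le_zero, Finset.card_eq_zero] at hk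
    rw [hk] at hmem
    exact (Finset.notMem_empty l) hmem
  | succ k ih =>
    intro S hS hk
    by_cases hall : ∀ l ∈ S, Deep l
    · exact ⟨S, hS, rfl, hall⟩
    · push Not at hall
      obtain ⟨ℓ₀, hℓ₀S, hℓ₀, ℓ, hℓ, hℓS, hAdm⟩ := hstep S hS hall
      have hcard : (insert ℓ (S.erase ℓ₀)).card = S.card := by
        rw [Finset.card_insert_of_notMem (fun h ↦ hℓS (Finset.mem_of_mem_erase h)), Finset.card_erase_of_mem hℓ₀S]
        have : 0 < S.card := Finset.card_pos.mpr ⟨ℓ₀, hℓ₀S⟩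
        omega
      have hbad : ((insert ℓ (S.erase ℓ₀)).filter fun l ↦ ¬ Deep l).card ≤ k := by
        rw [Finset.filter_insert, if_neg (not_not.mpr hℓ), Finset.filter_erase,
          Finset.card_erase_of_mem (Finset.mem_filter.mpr ⟨hℓ₀S, hℓ₀⟩)]
        omega
      obtain ⟨S', hS', hcard', hdeep⟩ := ih _ hAdm hbad
      exact ⟨S', hS', hcard'.trans hcard, hdeep⟩

/-- **The loop in the engine's contradiction form** (LEAD memo §2: at a `k`-minimal primitive `n` with `k ≥ 1`, if every swap of a
non-deep prime for a deep one were imprimitive, reciprocity would be violated): from `engine` and any admissible `S₀`, an admissible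
set of the same size all of whose elements are deep. [cite: McCallumLMS1991, §5 proof of Prop. 5.2] [cite: Kolyvagin1991MathAnn, Thm. 2.2] -/
theorem exists_all_deep_of_engine (Deep : ℕ → Prop) (Adm : Finset ℕ → Prop)
    (engine : ∀ S, Adm S → ∀ ℓ₀ ∈ S, ¬ Deep ℓ₀ →
      (∀ ℓ₁ ∈ S, ¬ Deep ℓ₁ → ∀ ℓ, Deep ℓ → ℓ ∉ S → ¬ Adm (insert ℓ (S.erase ℓ₁))) → False)
    (S₀ : Finset ℕ) (hS₀ : Adm S₀) :
    ∃ S, Adm S ∧ S.card = S₀.card ∧ ∀ l ∈ S, Deep l := by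
  refine exists_all_deep_of_exists_swap Deep Adm (fun S hS hex ↦ ?_) S₀ hS₀
  obtain ⟨ℓ₀, hℓ₀S, hℓ₀⟩ := hex
  by_contra hno
  push Not at hno
  exact engine S hS ℓ₀ hℓ₀S hℓ₀ fun ℓ₁ hℓ₁S hℓ₁ ℓ hℓ hℓS hAdm ↦ hno ℓ₁ hℓ₁S hℓ₁ ℓ hℓ hℓS hAdm

/-- The same loop with the invariant carrying the size explicitly (`Adm S := S.card = r ∧ P S`), the shape of
`…RTBottomRung.exists_deep_primitive_of_shallow`. [cite: Kolyvagin1991MathAnn, Thm. 2.2 (proof)] -/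
theorem exists_all_deep_of_engine_card (Deep : ℕ → Prop) (P : Finset ℕ → Prop) (r : ℕ)
    (engine : ∀ S, S.card = r → P S → ∀ ℓ₀ ∈ S, ¬ Deep ℓ₀ →
      (∀ ℓ₁ ∈ S, ¬ Deep ℓ₁ → ∀ ℓ, Deep ℓ → ℓ ∉ S → ¬ P (insert ℓ (S.erase ℓ₁))) → False)
    (S₀ : Finset ℕ) (hS₀ : S₀.card = r) (hP₀ : P S₀) :
    ∃ S, S.card = r ∧ P S ∧ ∀ l ∈ S, Deep l := by
  classical
  obtain ⟨S, ⟨hSr, hSP⟩, -, hdeep⟩ := exists_all_deep_of_engine Deep (fun S ↦ S.card = r ∧ P S)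
    (fun S hS ℓ₀ hℓ₀S hℓ₀ hall ↦ engine S hS.1 hS.2 ℓ₀ hℓ₀S hℓ₀ fun ℓ₁ hℓ₁S hℓ₁ ℓ hℓ hℓS hPswap ↦
      hall ℓ₁ hℓ₁S hℓ₁ ℓ hℓ hℓS ⟨by
        rw [Finset.card_insert_of_notMem (fun h ↦ hℓS (Finset.mem_of_mem_erase h)), Finset.card_erase_of_mem hℓ₁S]
        have : 0 < S.card := Finset.card_pos.mpr ⟨ℓ₁, hℓ₁S⟩
        omega, hPswap⟩) S₀ ⟨hS₀, hP₀⟩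
  exact ⟨S, hSr, hSP, hdeep⟩

end Summit.BirchSwinnertonDyer.BirchSwinnertonDyer.Theorems.GenusExact.PlusDescent
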